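import Summits.Ventures.Crystal3D.Theorems.StickyWulffConstantGenericWallFloorJunkCapper
import Summits.Ventures.Crystal3D.Theorems.StickyWulffConstantGenericWallFloorExactOnly
import HarnessLib

/-!
# Twin caps are a junk-ball count: `#TC₁ ≤ 12 · #junk`
# (crux `GenericWallFloor`, line `WallLedgerG`; the residual of the general rung / chain ledger)

HONEST FRAMING. Part of the venture `Summits/Ventures/Crystal3D` (cell `crystal3d-full`), helper
`--supports` the crux `GenericWallFloor` (stmt-Ventures-19480), registered line `WallLedgerG`, open stub
`stub_twoSlabAdhesion`.  Both 19480-p1's `general_twoSlabAdhesion_modulo_twinCaps` and the planner's chain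
ledger (ROUTE §81(3), N-TC) leave the residual `#TC` (twin-capped exits/tops of a grain); §81(3) asserts it
«is a DEFECT count».  Here as a theorem: **`card_twinCapped_le_junk`** — in a `1`-separated
configuration of a NON-co-axial pair, the grain-1 balls carrying an exact twin cap (unit `{111}` normal
`n` of the grain, twin images of the three positive slots occupied) are at most `12 ×` the balls of `X`
lying on NEITHER lattice (every twin cap has a junk capper at distance `1`, `exists_junk_capper` +
`dist_capper_eq_one`; a ball has at most twelve neighbours, `IsKissingAround.card_le_twelve`).  Any `TC`
filter of the rungs is contained in the left-hand filter (monotonicity), so `#TC₁ ≤ 12 · #junk`.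
(The sharp multiplicity is `3` — a twin position touches exactly three lattice sites — not needed here.)

WHAT THIS IS NOT: junk balls are not yet shown to PAY (stack propagation via `twinFrame_of_twinCap` +
`trichotomy_of_exactOnly` is the lane's N5); rung F-C1 not moved.
-/

noncomputable section

namespace Summit.Ventures.Crystal3D.Theorems

open Finset
open Literature.MathematicalPhysics.StatisticalMechanics (fccStacking barlowStacking IsHaggSeq)
open scoped InnerProductSpace

/-- The capper sits at distance `1` from the capped ball. -/
theorem dist_capper_eq_one (A : EuclideanSpace ℝ (Fin 3) ≃ₗᵢ[ℝ] EuclideanSpace ℝ (Fin 3))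
    {n : EuclideanSpace ℝ (Fin 3)} (hn : ‖n‖ = 1)
    (hmenu : ∀ w ∈ fccSlots, ⟪A w, n⟫_ℝ = 0 ∨ ⟪A w, n⟫_ℝ = Real.sqrt (2 / 3) ∨ ⟪A w, n⟫_ℝ = -Real.sqrt (2 / 3))
    (t : EuclideanSpace ℝ (Fin 3)) {w : EuclideanSpace ℝ (Fin 3)} (hw : w ∈ fccSlots) :
    dist (t - A w + (2 * ⟪A w, n⟫_ℝ) • n) t = 1 := by
  have h23 : Real.sqrt (2 / 3) ^ 2 = 2 / 3 := Real.sq_sqrt (by norm_num)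
  have hnn : ⟪n, n⟫_ℝ = 1 := by rw [real_inner_self_eq_norm_sq, hn, one_pow]
  have hww : ⟪A w, A w⟫_ℝ = 1 := by
    rw [real_inner_self_eq_norm_sq, LinearIsometryEquiv.norm_map, norm_eq_one_of_mem_fccSlots hw, one_pow]
  have hsq : ⟪A w, n⟫_ℝ ^ 2 = 0 ∨ ⟪A w, n⟫_ℝ ^ 2 = 2 / 3 := by
    rcases hmenu w hw with h | h | h
    · left; rw [h]; ring
    · right; rw [h, h23]
    · right; rw [h, neg_sq, h23]
  rw [dist_eq_norm, show t - A w + (2 * ⟪A w, n⟫_ℝ) • n - t = -A w + (2 * ⟪A w, n⟫_ℝ) • n by abel]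
  have h2 : ‖-A w + (2 * ⟪A w, n⟫_ℝ) • n‖ ^ 2 = 1 := by
    rw [← real_inner_self_eq_norm_sq, inner_add_left, inner_add_right, inner_add_right, inner_neg_left,
      inner_neg_left, inner_neg_right, inner_neg_right, real_inner_smul_left, real_inner_smul_right,
      real_inner_smul_left, real_inner_smul_right, hww, hnn, real_inner_comm (A w) n]
    rcases hsq with h | h <;> nlinarith [h]
  exact (sq_eq_sq₀ (norm_nonneg _) zero_le_one).1 (by rw [h2, one_pow])

open scoped Classical in
/-- **TWIN CAPS ARE A JUNK-BALL COUNT.**  In a `1`-separated configuration `X` of a NON-co-axial pair, the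
grain-1 balls carrying an exact twin cap (some unit `{111}` normal `n` of the grain with the twin images
of all three positive slots occupied) number at most `12 ×` the JUNK balls (balls of `X` on neither
lattice): each twin cap has a junk capper at distance `1` (`exists_junk_capper`), and a ball has at most
twelve neighbours.  Every `TC` set of the general-filling rung / chain ledger is contained in the left
filter, so `#TC₁ ≤ 12 · #junk`. -/
theorem card_twinCapped_le_junk
    (A₁ A₂ : EuclideanSpace ℝ (Fin 3) ≃ₗᵢ[ℝ] EuclideanSpace ℝ (Fin 3)) (t₁ t₂ : EuclideanSpace ℝ (Fin 3))
    (hnc : ¬ ∃ (L' : EuclideanSpace ℝ (Fin 3) ≃ₗᵢ[ℝ] EuclideanSpace ℝ (Fin 3))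
      (s₁ s₂ : EuclideanSpace ℝ (Fin 3)) (σ σ' : ℤ → ℤ), IsHaggSeq σ ∧ IsHaggSeq σ' ∧
      (fun p => A₁ p + t₁) '' fccStacking 1 (Real.sqrt (2 / 3)) ⊆
        (fun p => L' p + s₁) '' barlowStacking 1 (Real.sqrt (2 / 3)) σ ∧
      (fun p => A₂ p + t₂) '' fccStacking 1 (Real.sqrt (2 / 3)) ⊆
        (fun p => L' p + s₂) '' barlowStacking 1 (Real.sqrt (2 / 3)) σ')
    {X : Finset (EuclideanSpace ℝ (Fin 3))} (hX : ∀ p ∈ X, ∀ q ∈ X, p ≠ q → 1 ≤ dist p q) :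
    (X.filter fun t => t ∈ (fun p => A₁ p + t₁) '' fccStacking 1 (Real.sqrt (2 / 3)) ∧
        ∃ n : EuclideanSpace ℝ (Fin 3), ‖n‖ = 1 ∧
          (∀ w ∈ fccSlots, ⟪A₁ w, n⟫_ℝ = 0 ∨ ⟪A₁ w, n⟫_ℝ = Real.sqrt (2 / 3) ∨
            ⟪A₁ w, n⟫_ℝ = -Real.sqrt (2 / 3)) ∧
          ∀ w ∈ fccSlots, 0 < ⟪A₁ w, n⟫_ℝ → t - A₁ w + (2 * ⟪A₁ w, n⟫_ℝ) • n ∈ X).card ≤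
      12 * (X.filter fun j => j ∉ (fun p => A₁ p + t₁) '' fccStacking 1 (Real.sqrt (2 / 3)) ∧
        j ∉ (fun p => A₂ p + t₂) '' fccStacking 1 (Real.sqrt (2 / 3))).card := by
  set TC := X.filter fun t => t ∈ (fun p => A₁ p + t₁) '' fccStacking 1 (Real.sqrt (2 / 3)) ∧
        ∃ n : EuclideanSpace ℝ (Fin 3), ‖n‖ = 1 ∧
          (∀ w ∈ fccSlots, ⟪A₁ w, n⟫_ℝ = 0 ∨ ⟪A₁ w, n⟫_ℝ = Real.sqrt (2 / 3) ∨
            ⟪A₁ w, n⟫_ℝ = -Real.sqrt (2 / 3)) ∧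
          ∀ w ∈ fccSlots, 0 < ⟪A₁ w, n⟫_ℝ → t - A₁ w + (2 * ⟪A₁ w, n⟫_ℝ) • n ∈ X with hTC
  set J := X.filter fun j => j ∉ (fun p => A₁ p + t₁) '' fccStacking 1 (Real.sqrt (2 / 3)) ∧
        j ∉ (fun p => A₂ p + t₂) '' fccStacking 1 (Real.sqrt (2 / 3)) with hJ
  -- every twin-capped ball has a junk neighbour
  have key : ∀ t ∈ TC, ∃ j ∈ J, dist j t = 1 := by
    intro t ht
    obtain ⟨htX, htΛ, n, hn, hmenu, hcap⟩ := Finset.mem_filter.1 ht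
    obtain ⟨w, hw, -, hcX, hc₁, hc₂⟩ := exists_junk_capper A₁ A₂ t₁ t₂ hnc hn hmenu htΛ hcap
    exact ⟨_, Finset.mem_filter.2 ⟨hcX, hc₁, hc₂⟩, dist_capper_eq_one A₁ hn hmenu t hw⟩
  -- so `TC ⊆ ⋃_{j ∈ J} N(j)` and each `N(j)` has at most twelve members
  have hsub : TC ⊆ J.biUnion fun j => X.filter fun q => dist j q = 1 := by
    intro t ht
    obtain ⟨j, hj, hd⟩ := key t ht
    exact Finset.mem_biUnion.2 ⟨j, hj, Finset.mem_filter.2 ⟨(Finset.mem_filter.1 ht).1, hd⟩⟩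
  have hN : ∀ j ∈ J, (X.filter fun q => dist j q = 1).card ≤ 12 := by
    intro j _
    have hkiss : IsKissingAround j (X.filter fun q => dist j q = 1) :=
      ⟨fun s hs => (Finset.mem_filter.1 hs).2,
        fun s hs t ht hst => hX s (Finset.mem_filter.1 hs).1 t (Finset.mem_filter.1 ht).1 hst⟩
    exact hkiss.card_le_twelve
  calc TC.card ≤ (J.biUnion fun j => X.filter fun q => dist j q = 1).card := Finset.card_le_card hsub
    _ ≤ ∑ j ∈ J, (X.filter fun q => dist j q = 1).card := Finset.card_biUnion_le
    _ ≤ ∑ _j ∈ J, 12 := Finset.sum_le_sum hN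
    _ = 12 * J.card := by rw [Finset.sum_const, smul_eq_mul, mul_comm]

end Summit.Ventures.Crystal3D.Theorems

end
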